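import Summits.QuantumFields.BalabanUV.Beta.D1BFx.KernelFormOperators

/-!
# Road BF-x, slot (K) dictionary brick B6 (DICT-H), part 1 «OPS»: superposition of a vector-kernel column family against a bounded weight,
# the `R = 1 − P` term through the column series, and the gauge multiplier `−n²·G′R(δA)` in B1's `RG` shape vs B4∕B5's `Gf ∘ Rf`

HONEST DEPENDENCY (page 1, mandatory): continuum YM on T⁴ ⇐ BetaPertH ∧ nine spine estimates (0/9 proved); BetaPertH ⇐ (D1) ∧ (D4) ∧
CAP+tail; G-an2-4 gates asym, D1 and NE2/3/4.  HONEST FRAMING (cell contract, verbatim): «discharging `BetaPertH` makes Bałaban's UV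
stability UNCONDITIONAL — a real constructive-QFT result; it is NOT the continuum limit and NOT the Clay problem.»  THIS MODULE is [folklore]
absolutely convergent lattice bookkeeping over leaf-03-g6's brick B4 `KernelFormOperators` (`kerOp`, `kerOp₁`, `Pf`, `Rf`, `kerOp_kerOp`,
`hasSum_*_kerOp₁`, `comp_Ggh_Rgt_eq`, `blockSum_Gf_Rf_eq_zero`), the owner's B5 `TowerEquationForms` (`Gf`, `codiff₁_dz_Gf_of_blockSum_eq_zero`) and
B1 `LandauMultiplierMean`; no `def`, no `def … : Prop`, nothing cited, 0 sorry.  It asserts NO line of the dictionary; part 2 assembles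
`KKTFluctuationUnique.SolvesKKT` from these pieces under the DISPLAYED hypotheses X₁a∕X₁b.  0∕4 binders of row D1 discharged; NOT D1, NOT
BetaPertH, NOT continuum, NOT Clay.

ABSOLUTE RULE (cell charter, verbatim): «No internally-minted statement may enter as a cited fact. Every hypothesis is either kernel-proved
in this package or a verbatim quotation of a PUBLISHED theorem with page reference. The manuscript(s) under audit are NOT citable for their
own disputed steps — they are the thing under adjudication; programme-internal (2001/route/tribunal) claims are never citable.»

CONTENT (`d + 1 = 4`; `K : MKer 4 (Fin 4)` a vector kernel with columns `col K m z := fun κ p ↦ K p z κ m`; `b : Form1 4 ℝ` a bounded weight;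
the column superposition at `z` is `fun κ p ↦ Σ_m K p z κ m · b m z`, whose `z`-series is B4's `kerOp₁ K b`).
* §1 finite superposition through the linear stencils: `codiff₁_superpos`, `dz_superpos₀`, `kerOp_superpos` (bounded summands), `Rf_superpos`,
  `opEL_superpos'` ∕ `QtQ_superpos` (`KernelSpecInstance.op₁₁_superpos` BY NAME), `delta1_superpos`.
* §2 bounds: `abs_codiff₁_le_of_bound`, `abs_col_le`, `abs_superpos_le`, `abs_codiff₁_superpos_le_exp` (the codifferential of the column
  superposition at `z` decays like `e^{−δ|q−z|₁}`).
* §3 **`hasSum_kerOp_codiff₁_superpos`**: for a decaying scalar kernel `L` (e.g. `Rgt n a`), `z ↦ (L (δ F_z))(p)` sums to `(L (δ (kerOp₁ K b)))(p)`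
  (Fubini, B4's `summable_uncurry_of_rowMajorant`); **`hasSum_dz_Rf_codiff₁_superpos`** — the `R`-term of X₁a through the column series.
* §4 the gauge multiplier: **`tsum_RG_mul_eq_Gf_Rf`** (`Σ'_q (R∘G′)(q,p)·g q = (Gf n a (Rf n a g)) p`, bounded `g`), **`codiff₁_dz_neg_sq_Gf_Rf`**
  (`codiff₁ (dz (p ↦ −n²·Gf n a (Rf n a g) p)) = −Rf n a g`), `blockSum_neg_sq_Gf_Rf` (`= 0`).
Unit `b2b-balaban-beta-d1-formalise-leaf-06` (gen 6), 2026-08-20; `DICT-BRICKS.md` row B6; INTENT «DICT-B6» (journal).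
-/

namespace Summit.QuantumFields.BalabanUV.Beta.D1BFx.LandauDictionaryHOps

open Finset
open scoped BigOperators
open Literature.MathematicalPhysics.QuantumFieldTheory.Balaban1983to89
open Literature.MathematicalPhysics.QuantumFieldTheory.Balaban1983to89.Beta
open ExpKernelCalculus (Site MKer Decays comp Zl Zl_nonneg summable_exp_shift tsum_exp_shift)
open B12Sec2to5 (l1 l1_nonneg)
open AffineAveraging (Form0 Form1 unitVec dz curv curvAdj codiff₁ blockSum contourSum)
open AffineReproduction (contourSumAdj)
open KKTFluctuationKernel (delta1 delta1_apply)
open KernelSpecInstance (hasSum_dz hasSum_codiff₁ opEL opQ opΦ opEL_apply opQ_apply opΦ_apply op₁₁_superpos dz_smul codiff₁_smul)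
open Summit.QuantumFields.BalabanUV.Beta.TameKernelCalculus (Spr)
open GhostLeg (Ggh spr_Ggh)
open RProjector (Pgt)
open RProjectorJet (RG)
open RJetProjector (Rgt decays_Rgt)
open LandauMultiplierMean (spr_Pgt)
open TowerEquationForms (Gf codiff₁_dz_Gf_of_blockSum_eq_zero)
open KernelFormOperators (kerOp kerOp₁ Pf Rf kerOp_apply Rf_eq summable_ker_mul hasSum_kerOp abs_kerOp_le spr_Rgt Rf_eq_kerOp_Rgt
  exists_bound_Rf summable_uncurry_of_rowMajorant kerOp_kerOp comp_Ggh_Rgt_eq blockSum_Gf_Rf_eq_zero abs_col_mul_le hasSum_kerOp₁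
  hasSum_codiff₁_kerOp₁ bound_nonneg)

noncomputable section

/-! ## §1 Finite superposition through the linear stencils -/

section Superpos

variable {ι : Type*} [Fintype ι]

/-- [folklore] `δ` of a finite superposition of 1-forms: `codiff₁ (Σ_m W_m·c_m) p = Σ_m c_m·(codiff₁ W_m) p`. -/
theorem codiff₁_superpos (W : ι → Form1 4 ℝ) (c : ι → ℝ) (p : Site 4) :
    codiff₁ (fun κ x => ∑ m, W m κ x * c m) p = ∑ m, c m * codiff₁ (W m) p := by
  simp only [AffineAveraging.codiff₁]
  rw [show (∑ κ : Fin 4, ((∑ m, W m κ (p - unitVec κ) * c m) - ∑ m, W m κ p * c m))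
      = ∑ κ : Fin 4, ∑ m, (W m κ (p - unitVec κ) * c m - W m κ p * c m) from
    Finset.sum_congr rfl fun κ _ => by rw [Finset.sum_sub_distrib], Finset.sum_comm]
  refine Finset.sum_congr rfl fun m _ => ?_
  rw [Finset.mul_sum]
  exact Finset.sum_congr rfl fun κ _ => by ring

/-- [folklore] `d` of a finite superposition of 0-forms: `dz (Σ_m c_m·g_m) κ x = Σ_m c_m·(dz g_m) κ x`. -/
theorem dz_superpos₀ (g : ι → Form0 4 ℝ) (c : ι → ℝ) (κ : Fin 4) (x : Site 4) :
    dz (fun p => ∑ m, c m * g m p) κ x = ∑ m, c m * dz (g m) κ x := by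
  simp only [AffineAveraging.dz, ← Finset.sum_sub_distrib, mul_sub]

/-- [folklore] A decaying kernel operator through a finite superposition of BOUNDED 0-forms. -/
theorem kerOp_superpos {L : MKer 4 Unit} {C δ : ℝ} (hL : Decays L C δ) (hδ : 0 < δ) (g : ι → Form0 4 ℝ) (c : ι → ℝ)
    {M : ι → ℝ} (hg : ∀ m q, |g m q| ≤ M m) (p : Site 4) :
    kerOp L (fun q => ∑ m, c m * g m q) p = ∑ m, c m * kerOp L (g m) p := by
  simp only [kerOp_apply, Finset.mul_sum]
  have hs : ∀ m ∈ (Finset.univ : Finset ι), Summable fun q : Site 4 => c m * (L p q () () * g m q) :=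
    fun m _ => (summable_ker_mul hL hδ (hg m) p).mul_left (c m)
  rw [show (∑ m, c m * ∑' q : Site 4, L p q () () * g m q) = ∑ m, ∑' q : Site 4, c m * (L p q () () * g m q) from
    Finset.sum_congr rfl fun m _ => (tsum_mul_left).symm, ← Summable.tsum_finsetSum hs]
  exact tsum_congr fun q => Finset.sum_congr rfl fun m _ => by ring

/-- [folklore] **`R = 1 − P` THROUGH A FINITE SUPERPOSITION OF BOUNDED 0-forms** (`0 < a`): `Rf n a (Σ_m c_m·g_m) p = Σ_m c_m·(Rf n a g_m) p`. -/
theorem Rf_superpos (n : ℕ) [NeZero n] (a : ℝ) (ha : 0 < a) (g : ι → Form0 4 ℝ) (c : ι → ℝ) {M : ι → ℝ}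
    (hg : ∀ m q, |g m q| ≤ M m) (p : Site 4) :
    Rf n a (fun q => ∑ m, c m * g m q) p = ∑ m, c m * Rf n a (g m) p := by
  obtain ⟨C, δ, hδ, hP⟩ := spr_Pgt n a ha
  simp only [Rf_eq, Pi.sub_apply, mul_sub, Finset.sum_sub_distrib]
  rw [kerOp_superpos hP hδ g c hg p]

/-- [folklore] **`curvAdj ∘ curv` THROUGH A FINITE SUPERPOSITION** (`KernelSpecInstance.op₁₁_superpos opEL`). -/
theorem opEL_superpos' (W : ι → Form1 4 ℝ) (c : ι → ℝ) (μ : Fin 4) (y : Site 4) :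
    curvAdj (curv (fun κ x => ∑ m, W m κ x * c m)) μ y = ∑ m, c m * curvAdj (curv (W m)) μ y := by
  classical
  have h := op₁₁_superpos opEL (fun i : Fin (Fintype.card ι) => W ((Fintype.equivFin ι).symm i))
    (fun i => c ((Fintype.equivFin ι).symm i)) μ y
  simp only [opEL_apply] at h
  have e1 : (fun κ x => ∑ i : Fin (Fintype.card ι), W ((Fintype.equivFin ι).symm i) κ x * c ((Fintype.equivFin ι).symm i))
      = fun κ x => ∑ m, W m κ x * c m := by
    funext κ x
    exact (Fintype.equivFin ι).symm.sum_comp (fun m => W m κ x * c m)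
  have e2 : ∑ i : Fin (Fintype.card ι), c ((Fintype.equivFin ι).symm i) * curvAdj (curv (W ((Fintype.equivFin ι).symm i))) μ y
      = ∑ m, c m * curvAdj (curv (W m)) μ y :=
    (Fintype.equivFin ι).symm.sum_comp (fun m => c m * curvAdj (curv (W m)) μ y)
  rw [e1, e2] at h
  exact h

/-- [folklore] **`𝒬ᵀ𝒬` THROUGH A FINITE SUPERPOSITION** (`op₁₁_superpos` at `opΦ n ∘ₗ opQ n`). -/
theorem QtQ_superpos (n : ℕ) (W : ι → Form1 4 ℝ) (c : ι → ℝ) (μ : Fin 4) (y : Site 4) :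
    contourSumAdj n (contourSum n (fun κ x => ∑ m, W m κ x * c m)) μ y = ∑ m, c m * contourSumAdj n (contourSum n (W m)) μ y := by
  classical
  have h := op₁₁_superpos ((opΦ (d := 4) n).comp (opQ n)) (fun i : Fin (Fintype.card ι) => W ((Fintype.equivFin ι).symm i))
    (fun i => c ((Fintype.equivFin ι).symm i)) μ y
  simp only [LinearMap.comp_apply, opΦ_apply, opQ_apply] at h
  have e1 : (fun κ x => ∑ i : Fin (Fintype.card ι), W ((Fintype.equivFin ι).symm i) κ x * c ((Fintype.equivFin ι).symm i))
      = fun κ x => ∑ m, W m κ x * c m := by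
    funext κ x
    exact (Fintype.equivFin ι).symm.sum_comp (fun m => W m κ x * c m)
  have e2 : ∑ i : Fin (Fintype.card ι), c ((Fintype.equivFin ι).symm i) * contourSumAdj n (contourSum n (W ((Fintype.equivFin ι).symm i))) μ y
      = ∑ m, c m * contourSumAdj n (contourSum n (W m)) μ y :=
    (Fintype.equivFin ι).symm.sum_comp (fun m => c m * contourSumAdj n (contourSum n (W m)) μ y)
  rw [e1, e2] at h
  exact h

/-- [folklore] The delta forces through a finite superposition over the bond direction: `Σ_m c_m·δ_{(m,z)}(κ,x) = [x = z]·c_κ`. -/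
theorem delta1_superpos (c : Fin 4 → ℝ) (z : Site 4) (κ : Fin 4) (x : Site 4) :
    ∑ m : Fin 4, c m * delta1 m z κ x = if x = z then c κ else 0 := by
  simp only [delta1_apply, mul_ite, mul_one, mul_zero]
  by_cases hx : x = z
  · simp [hx]
  · simp [hx]

end Superpos

/-! ## §2 Bounds -/

section Bounds

/-- [folklore] The codifferential of a bounded 1-form is bounded: `|δA| ≤ 8·B`. -/
theorem abs_codiff₁_le_of_bound {A : Form1 4 ℝ} {B : ℝ} (hA : ∀ κ x, |A κ x| ≤ B) (q : Site 4) : |codiff₁ A q| ≤ 8 * B := by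
  simp only [AffineAveraging.codiff₁]
  calc |∑ κ : Fin 4, (A κ (q - unitVec κ) - A κ q)| ≤ ∑ κ : Fin 4, |A κ (q - unitVec κ) - A κ q| := Finset.abs_sum_le_sum_abs _ _
    _ ≤ ∑ _κ : Fin 4, (B + B) := Finset.sum_le_sum fun κ _ => (abs_sub _ _).trans (add_le_add (hA _ _) (hA _ _))
    _ = 8 * B := by rw [Finset.sum_const, Finset.card_univ, Fintype.card_fin, nsmul_eq_mul]; push_cast; ring

variable {K : MKer 4 (Fin 4)} {C δ M : ℝ} {b : Form1 4 ℝ}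

/-- [folklore] A column of a decaying vector kernel is bounded by the constant: `|K p z κ m| ≤ C`. -/
theorem abs_col_le (hK : Decays K C δ) (hδ : 0 ≤ δ) (m : Fin 4) (z : Site 4) (κ : Fin 4) (p : Site 4) : |K p z κ m| ≤ C := by
  refine (hK p z κ m).trans ?_
  have h1 : Real.exp (-δ * l1 (p - z)) ≤ 1 := by
    rw [Real.exp_le_one_iff]; nlinarith [l1_nonneg (p - z)]
  calc C * Real.exp (-δ * l1 (p - z)) ≤ C * 1 := mul_le_mul_of_nonneg_left h1 (hK.nonneg 0)
    _ = C := mul_one C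

/-- [folklore] The column superposition at `z` is bounded: `|Σ_m K p z κ m · b m z| ≤ 4·C·M`. -/
theorem abs_superpos_le (hK : Decays K C δ) (hδ : 0 ≤ δ) (hb : ∀ l z, |b l z| ≤ M) (z : Site 4) (κ : Fin 4) (p : Site 4) :
    |∑ m, K p z κ m * b m z| ≤ 4 * (C * M) := by
  refine (abs_col_mul_le hK hb κ p z).trans ?_
  have h1 : Real.exp (-δ * l1 (p - z)) ≤ 1 := by
    rw [Real.exp_le_one_iff]; nlinarith [l1_nonneg (p - z)]
  have h0 : 0 ≤ 4 * (C * M) := by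
    have := (hK.nonneg 0); have := bound_nonneg (hb 0); positivity
  calc 4 * (C * M) * Real.exp (-δ * l1 (p - z)) ≤ 4 * (C * M) * 1 := mul_le_mul_of_nonneg_left h1 h0
    _ = 4 * (C * M) := mul_one _

/-- [folklore] A backward unit step costs at most a factor `e^{δ}`: `e^{−δ|q−e_κ−z|₁} ≤ e^{δ}·e^{−δ|q−z|₁}` (`δ ≥ 0`). -/
theorem exp_step_le (hδ : 0 ≤ δ) (q z : Site 4) (κ : Fin 4) :
    Real.exp (-δ * l1 (q - unitVec κ - z)) ≤ Real.exp δ * Real.exp (-δ * l1 (q - z)) := by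
  rw [← Real.exp_add, Real.exp_le_exp]
  have ht : l1 (q - z) ≤ l1 (unitVec κ : Site 4) + l1 (q - unitVec κ - z) := by
    have h := ExpKernelCalculus.l1_sub_triangle q (q - unitVec κ) z
    rwa [show q - (q - unitVec κ) = unitVec κ by abel] at h
  have hu : l1 (unitVec κ : Site 4) = 1 := by
    unfold B12Sec2to5.l1
    rw [Finset.sum_eq_single κ (fun i _ hi => by simp [AffineAveraging.unitVec, hi])
      (fun h => absurd (Finset.mem_univ κ) h)]
    simp [AffineAveraging.unitVec]
  rw [hu] at ht
  nlinarith

/-- [folklore] **THE CODIFFERENTIAL OF THE COLUMN SUPERPOSITION AT `z` DECAYS LIKE `e^{−δ|q−z|₁}`**: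
`|δ(Σ_m K(·,z)_{·m} b_m(z))(q)| ≤ 4·(4CM)·(e^{δ}+1)·e^{−δ|q−z|₁}`. -/
theorem abs_codiff₁_superpos_le_exp (hK : Decays K C δ) (hδ : 0 ≤ δ) (hb : ∀ l z, |b l z| ≤ M) (z q : Site 4) :
    |codiff₁ (fun κ p => ∑ m, K p z κ m * b m z) q| ≤ 4 * (4 * (C * M)) * (Real.exp δ + 1) * Real.exp (-δ * l1 (q - z)) := by
  have h0 : 0 ≤ 4 * (C * M) := by
    have := (hK.nonneg 0); have := bound_nonneg (hb 0); positivity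
  simp only [AffineAveraging.codiff₁]
  have hκ : ∀ κ : Fin 4, |(∑ m, K (q - unitVec κ) z κ m * b m z) - ∑ m, K q z κ m * b m z|
      ≤ 4 * (C * M) * (Real.exp δ + 1) * Real.exp (-δ * l1 (q - z)) := by
    intro κ
    refine (abs_sub _ _).trans ?_
    have h1 := abs_col_mul_le hK hb κ (q - unitVec κ) z
    have h2 := abs_col_mul_le hK hb κ q z
    have h3 := exp_step_le hδ q z κ
    calc |∑ m, K (q - unitVec κ) z κ m * b m z| + |∑ m, K q z κ m * b m z|
        ≤ 4 * (C * M) * Real.exp (-δ * l1 (q - unitVec κ - z)) + 4 * (C * M) * Real.exp (-δ * l1 (q - z)) := add_le_add h1 h2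
      _ ≤ 4 * (C * M) * (Real.exp δ * Real.exp (-δ * l1 (q - z))) + 4 * (C * M) * Real.exp (-δ * l1 (q - z)) :=
          add_le_add (mul_le_mul_of_nonneg_left h3 h0) le_rfl
      _ = 4 * (C * M) * (Real.exp δ + 1) * Real.exp (-δ * l1 (q - z)) := by ring
  calc |∑ κ : Fin 4, ((∑ m, K (q - unitVec κ) z κ m * b m z) - ∑ m, K q z κ m * b m z)|
      ≤ ∑ κ : Fin 4, |(∑ m, K (q - unitVec κ) z κ m * b m z) - ∑ m, K q z κ m * b m z| := Finset.abs_sum_le_sum_abs _ _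
    _ ≤ ∑ _κ : Fin 4, 4 * (C * M) * (Real.exp δ + 1) * Real.exp (-δ * l1 (q - z)) := Finset.sum_le_sum fun κ _ => hκ κ
    _ = 4 * (4 * (C * M)) * (Real.exp δ + 1) * Real.exp (-δ * l1 (q - z)) := by
        rw [Finset.sum_const, Finset.card_univ, Fintype.card_fin, nsmul_eq_mul]; push_cast; ring

end Bounds

/-! ## §3 A scalar kernel operator through the column series: the `R`-term of X₁a -/

section Exchange

variable {K : MKer 4 (Fin 4)} {C δ M : ℝ} {b : Form1 4 ℝ} {L : MKer 4 Unit} {CL δL : ℝ}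

/-- [folklore] **A DECAYING SCALAR KERNEL OPERATOR THROUGH THE COLUMN SERIES**: for decaying `L`, `K` and bounded `b`,
`z ↦ (L (δ F_z))(p)` sums to `(L (δ (kerOp₁ K b)))(p)` where `F_z := (κ,p) ↦ Σ_m K p z κ m · b m z` (Fubini with the row of `L` at `p` as
summable weight and the `e^{−δ|q−z|₁}` decay of `δ F_z`). -/
theorem hasSum_kerOp_codiff₁_superpos (hL : Decays L CL δL) (hδL : 0 < δL) (hK : Decays K C δ) (hδ : 0 < δ)
    (hb : ∀ l z, |b l z| ≤ M) (p : Site 4) :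
    HasSum (fun z : Site 4 => kerOp L (codiff₁ (fun κ p => ∑ m, K p z κ m * b m z)) p)
      (kerOp L (codiff₁ (kerOp₁ K b)) p) := by
  have hCL : 0 ≤ CL := hL.nonneg ()
  have h0 : 0 ≤ 4 * (C * M) := by
    have := (hK.nonneg 0); have := bound_nonneg (hb 0); positivity
  -- the double family G q z := L p q · δF_z q, product-type majorant with summable row weight in q
  set G : Site 4 → Site 4 → ℝ := fun q z => L p q () () * codiff₁ (fun κ p => ∑ m, K p z κ m * b m z) q with hGdef
  have hs : Summable (Function.uncurry G) := by
    refine summable_uncurry_of_rowMajorant (F := G) (φ := fun q => CL * Real.exp (-δL * l1 (p - q)))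
      ((summable_exp_shift hδL p).mul_left CL) (fun q => by positivity)
      (show 0 ≤ 4 * (4 * (C * M)) * (Real.exp δ + 1) by positivity) hδ fun q z => ?_
    rw [hGdef]
    simp only
    rw [abs_mul]
    exact mul_le_mul (hL p q () ()) (abs_codiff₁_superpos_le_exp hK hδ.le hb z q) (abs_nonneg _) (by positivity)
  have h₁ : ∀ q, Summable fun z => G q z := fun q => hs.prod_factor q
  have h₂ : ∀ z, Summable fun q => G q z := fun z => hs.prod_symm.prod_factor z
  -- the z-family of q-sums is summable and its sum is the exchanged double sum
  have hz : Summable fun z => ∑' q, G q z := hs.prod_symm.prod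
  have hval : ∑' z, ∑' q, G q z = kerOp L (codiff₁ (kerOp₁ K b)) p := by
    rw [hs.tsum_comm' h₁ h₂]
    rw [kerOp_apply]
    refine tsum_congr fun q => ?_
    rw [hGdef]
    simp only
    rw [tsum_mul_left, (hasSum_codiff₁_kerOp₁ hK hδ hb q).tsum_eq]
  have hterm : ∀ z, ∑' q, G q z = kerOp L (codiff₁ (fun κ p => ∑ m, K p z κ m * b m z)) p := fun z => by
    rw [kerOp_apply]
  rw [← hval]
  simpa only [hterm] using hz.hasSum

/-- [folklore] **THE `R`-TERM OF X₁a THROUGH THE COLUMN SERIES** (`0 < a`): `z ↦ (d (R (δ F_z)))_κ(x)` sums to `(d (R (δ (kerOp₁ K b))))_κ(x)`,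
`R = Rf n a` (= `kerOp (Rgt n a)` on bounded forms, B4 `Rf_eq_kerOp_Rgt`). -/
theorem hasSum_dz_Rf_codiff₁_superpos (n : ℕ) [NeZero n] (a : ℝ) (ha : 0 < a) (hK : Decays K C δ) (hδ : 0 < δ)
    (hb : ∀ l z, |b l z| ≤ M) (κ : Fin 4) (x : Site 4) :
    HasSum (fun z : Site 4 => dz (Rf n a (codiff₁ (fun κ p => ∑ m, K p z κ m * b m z))) κ x)
      (dz (Rf n a (codiff₁ (kerOp₁ K b))) κ x) := by
  obtain ⟨CR, δR, hδR, hR⟩ := spr_Rgt n a ha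
  -- bounded inputs: `Rf = kerOp Rgt` on each of them
  have hbz : ∀ z q, |codiff₁ (fun κ p => ∑ m, K p z κ m * b m z) q| ≤ 8 * (4 * (C * M)) := fun z q =>
    abs_codiff₁_le_of_bound (fun κ p => abs_superpos_le hK hδ.le hb z κ p) q
  have hbA : ∀ q, |codiff₁ (kerOp₁ K b) q| ≤ 8 * (4 * C * Zl 4 δ * M) := fun q =>
    abs_codiff₁_le_of_bound (fun κ p => KernelFormOperators.abs_kerOp₁_le hK hδ hb κ p) q
  have e1 : ∀ z, Rf n a (codiff₁ (fun κ p => ∑ m, K p z κ m * b m z)) = kerOp (Rgt n a) (codiff₁ (fun κ p => ∑ m, K p z κ m * b m z)) :=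
    fun z => Rf_eq_kerOp_Rgt n a ha (hbz z)
  have e2 : Rf n a (codiff₁ (kerOp₁ K b)) = kerOp (Rgt n a) (codiff₁ (kerOp₁ K b)) := Rf_eq_kerOp_Rgt n a ha hbA
  simp only [e1, e2]
  exact hasSum_dz (F := fun z : Site 4 => kerOp (Rgt n a) (codiff₁ (fun κ p => ∑ m, K p z κ m * b m z)))
    (f := kerOp (Rgt n a) (codiff₁ (kerOp₁ K b))) (fun p => hasSum_kerOp_codiff₁_superpos hR hδR hK hδ hb p) κ x

end Exchange

/-! ## §4 The gauge multiplier: B1's `RG` shape vs `Gf ∘ Rf` -/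

section Multiplier

variable (n : ℕ) [NeZero n] (a : ℝ)

/-- [folklore] **`Σ'_q (R∘G′)(q,p)·g q = (G′(R g))(p)`** for bounded `g` (`0 < a`): B4's Fubini `kerOp_kerOp` + `comp_Ggh_Rgt_eq` + `Rf_eq_kerOp_Rgt`. -/
theorem tsum_RG_mul_eq_Gf_Rf (ha : 0 < a) {g : Form0 4 ℝ} {M : ℝ} (hg : ∀ q, |g q| ≤ M) (p : Site 4) :
    ∑' q : Site 4, RG (Ggh n a) (Pgt n a) q p () () * g q = Gf n a (Rf n a g) p := by
  obtain ⟨CG, δG, hδG, hG⟩ := spr_Ggh n a ha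
  obtain ⟨CR, δR, hδR, hR⟩ := spr_Rgt n a ha
  rw [Rf_eq_kerOp_Rgt n a ha hg]
  show _ = kerOp (Ggh n a) (kerOp (Rgt n a) g) p
  rw [kerOp_kerOp hG hδG hR hδR hg p, kerOp_apply]
  exact tsum_congr fun q => by rw [comp_Ggh_Rgt_eq n a ha]

/-- [folklore] `R g` is bounded with an explicit-existential bound (re-export of B4 for the statements below). -/
theorem exists_bound_Rf' (ha : 0 < a) {g : Form0 4 ℝ} {M : ℝ} (hg : ∀ q, |g q| ≤ M) : ∃ B' : ℝ, ∀ p, |Rf n a g p| ≤ B' :=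
  exists_bound_Rf n a ha hg

/-- [folklore] **THE TOWER INVERTS THE UNIT-LATTICE LAPLACIAN ON `R g`**: `codiff₁ (dz (Gf n a (Rf n a g))) p = (n²)⁻¹·(Rf n a g) p`
(B5's corollary with B4's `blockSum_Gf_Rf_eq_zero`). -/
theorem codiff₁_dz_Gf_Rf (ha : 0 < a) {g : Form0 4 ℝ} {M : ℝ} (hg : ∀ q, |g q| ≤ M) (p : Site 4) :
    codiff₁ (dz (Gf n a (Rf n a g))) p = ((n : ℝ) ^ 2)⁻¹ * Rf n a g p := by
  obtain ⟨B', hB'⟩ := exists_bound_Rf n a ha hg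
  exact codiff₁_dz_Gf_of_blockSum_eq_zero n a ha hB' (blockSum_Gf_Rf_eq_zero n a ha hg) p

/-- [folklore] **THE GAUGE MULTIPLIER `μ := −n²·G′(R g)` SOLVES `Δ₀ μ = −R g`.** -/
theorem codiff₁_dz_neg_sq_Gf_Rf (ha : 0 < a) {g : Form0 4 ℝ} {M : ℝ} (hg : ∀ q, |g q| ≤ M) (p : Site 4) :
    codiff₁ (dz (fun q => -((n : ℝ) ^ 2) * Gf n a (Rf n a g) q)) p = -Rf n a g p := by
  have hn : ((n : ℝ) ^ 2) ≠ 0 := pow_ne_zero 2 (by exact_mod_cast NeZero.ne n)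
  have e : (fun q => -((n : ℝ) ^ 2) * Gf n a (Rf n a g) q) = (-((n : ℝ) ^ 2)) • Gf n a (Rf n a g) := by
    funext q; simp only [Pi.smul_apply, smul_eq_mul]
  rw [e, dz_smul, codiff₁_smul, Pi.smul_apply, smul_eq_mul, codiff₁_dz_Gf_Rf n a ha hg p, ← mul_assoc, neg_mul,
    mul_inv_cancel₀ hn]
  ring

/-- [folklore] **… AND HAS ZERO BLOCK SUMS** (hypothesis (M) of `SolvesKKT`). -/
theorem blockSum_neg_sq_Gf_Rf (ha : 0 < a) {g : Form0 4 ℝ} {M : ℝ} (hg : ∀ q, |g q| ≤ M) (y : Site 4) :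
    blockSum n (fun q => -((n : ℝ) ^ 2) * Gf n a (Rf n a g) q) y = 0 := by
  simp only [AffineAveraging.blockSum, ← Finset.mul_sum]
  rw [show (∑ b ∈ AffineAveraging.box 4 n, Gf n a (Rf n a g) ((n : ℤ) • y + AffineAveraging.toSite b)) = blockSum n (Gf n a (Rf n a g)) y
    from rfl, blockSum_Gf_Rf_eq_zero n a ha hg y, mul_zero]

/-- [folklore] `μ` is bounded. -/
theorem exists_bound_neg_sq_Gf_Rf (ha : 0 < a) {g : Form0 4 ℝ} {M : ℝ} (hg : ∀ q, |g q| ≤ M) :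
    ∃ B' : ℝ, ∀ p, |-((n : ℝ) ^ 2) * Gf n a (Rf n a g) p| ≤ B' := by
  obtain ⟨B', hB'⟩ := KernelFormOperators.exists_bound_Gf_Rf n a ha hg
  refine ⟨(n : ℝ) ^ 2 * B', fun p => ?_⟩
  rw [abs_mul, abs_neg, abs_of_nonneg (by positivity : (0 : ℝ) ≤ (n : ℝ) ^ 2)]
  exact mul_le_mul_of_nonneg_left (hB' p) (by positivity)

end Multiplier

end

end Summit.QuantumFields.BalabanUV.Beta.D1BFx.LandauDictionaryHOps
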